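import Literature.NumberTheory.EllipticCurves.ZpExtensionEisensteinAdicTower
import Literature.NumberTheory.EllipticCurves.KummerMap
import Literature.NumberTheory.EllipticCurves.PointDivisibilityProofs
import Literature.NumberTheory.EllipticCurves.IwasawaAlgebraEisensteinFiniteQuotientSpanProofs
import Mathlib.LinearAlgebra.TensorProduct.RightExactness
import HarnessLib

/-!
# Exactness of the Eisenstein tower: `𝔪^{mk} = (p^k)` in `S_m`, `ker(S_m ↠ A_{m,k}) = 𝔪^{mk}`,
# `ker(A_{m,k+1} ↠ A_{m,k}) = p^k A_{m,k+1}`, and `ker(T_𝔮/p^{k+1} ↠ T_𝔮/p^k) = 𝔪^{mk} · (T_𝔮/p^{k+1})`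
# (proved theorems; no named fact, no instance, no notation)

Topic `NumberTheory/EllipticCurves` (companion of `IwasawaAlgebraEisensteinCoefficientRingProofs` and
`ZpExtensionEisensteinAdicTower`).  B. Howard, Compositio Math. 140 (2004), §1.6 reads the compact `T` over the
DVR `R` through the EXACT `𝔪`-adic tower `T/𝔪^{e_k}T` («`H¹_F(K,T) = lim H¹_F(K, T/𝔪^k T)`», arXiv:1202.6340
p. 12 L29–55); the cell's part-B typing (`Howard2004/DVRKolyvaginBound`, `DVRSetting.SatisfiesH`) records
exactness as the fields `unif`, `killed`, `ker_red : ker(T^{(k+1)} → T^{(k)}) = 𝔪^{e_k} T^{(k+1)}`,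
`algebraMap_surjective`, `ker_algebraMap : ker(R → R_k) = 𝔪^{e_k}`.  For the Eisenstein specialisation
(`R = S_m = Λ/(T^m + p)`, `R_k = A_{m,k} = Λ/(T^m + p, p^k)`, levels `T_𝔮/p^k = M_k ⊗ A_{m,k}(ψ)`, `e_k = mk`)
this file proves them:

* `IwasawaAlgebra.maximalIdeal_pow_mul_eq_span_natCast_pow` — **`𝔪_{S_m}^{mk} = (p^k)`** (`π^m = -p`);
* `IwasawaAlgebra.EisensteinCoeff.ker_ofSpec` — **`ker(S_m ↠ A_{m,k}) = 𝔪^{mk}`** (with `ofSpec_surjective`: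
  the `algebraMap_surjective`/`ker_algebraMap` clauses once `algebraMap := ofSpec`);
* `IwasawaAlgebra.EisensteinCoeff.reduce_eq_zero_iff` — `ker(A_{m,k'} ↠ A_{m,k}) = p^k A_{m,k'}` (`k ≤ k'`);
* **`ZpExtension.ker_eisensteinLevelRed`** — for `t k : M_{k+1} ↠ M_k` surjective with kernel `p^k M_{k+1}`
  (for `E`: `E[p^{k+1}] →(p·) E[p^k]`, kernel `E[p] = p^k E[p^{k+1}]`):
  `ker (eisensteinLevelRed κ ρ t hm k) = 𝔪_{S_m}^{mk} • ⊤` — right exactness of `⊗_ℤ`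
  (Mathlib `TensorProduct.map_ker`): the `ker_red` clause of `DVRSetting.SatisfiesH` for D1's tower
  (`eisensteinAdicTower`; for the shifted tower `eisensteinAdicTowerSucc` read `k+1`).

* `WeierstrassCurve.torsionGaloisModule_lift_surjective` / `…_lift_eq_zero_iff` — the `E`-instance of the two
  hypotheses (`ht`, `hkt`): any lift `t : E[p^{k+1}] → E[p^k]` of multiplication by `p` is onto with kernel
  `p^k E[p^{k+1}]` (`E(F̄)` divisible, tree `zsmul_geomPoints_surjective_holds`).

BSD is not proved by any of this; nothing about Selmer groups is asserted.

References: [Howard2004HeegnerKolyvagin] §1.6 (arXiv p. 12, L29–55), §2.2, proof of Thm. 2.2.10; [Washington1997]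
§13.2; [BourbakiAlgebre1a3] Ch. II §3 no. 6 Prop. 6 (right exactness of `⊗`; kernel of `u ⊗ v`).
-/

noncomputable section

open scoped TensorProduct ContRepresentation
open Field IsLocalRing

namespace Literature.NumberTheory.EllipticCurves

open Literature.NumberTheory.GaloisRepresentations

namespace IwasawaAlgebra

variable (p : ℕ) [hp : Fact p.Prime]

/-! ## §1 `𝔪^{mk} = (p^k)` in `S_m`; kernels of `S_m ↠ A_{m,k}` and `A_{m,k'} ↠ A_{m,k}` -/

/-- **`𝔪_{S_m}^{mk} = (p^k)`** in `S_m = Λ/(T^m + p)` (`𝔪 = (π)`, `π^m = -p`, so `π^{mk} = (-1)^k p^k`).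
[cite: Howard2004HeegnerKolyvagin, proof of Thm. 2.2.10 (𝔮 = T^m + p)] [cite: Washington1997, §13.2] -/
theorem maximalIdeal_pow_mul_eq_span_natCast_pow {m : ℕ} (hm : 1 ≤ m) (k : ℕ) :
    @maximalIdeal _ _ (isLocalRing_quotient_X_pow_add_C p hm) ^ (m * k) =
      Ideal.span {((p : IwasawaAlgebra p ⧸
        Ideal.span {(PowerSeries.X ^ m + PowerSeries.C (p : ℤ_[p]) : IwasawaAlgebra p)})) ^ k} := by
  letI := isLocalRing_quotient_X_pow_add_C p hm
  haveI := isDomain_quotient_X_pow_add_C p hm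
  have hπ : ((Ideal.Quotient.mk
      (Ideal.span {(PowerSeries.X ^ m + PowerSeries.C (p : ℤ_[p]) : IwasawaAlgebra p)})) PowerSeries.X) ^ m =
      -((p : IwasawaAlgebra p ⧸
        Ideal.span {(PowerSeries.X ^ m + PowerSeries.C (p : ℤ_[p]) : IwasawaAlgebra p)})) := by
    rw [natCast_eq_neg_mk_X_pow_quotient_X_pow_add_C p m, neg_neg]
  rw [maximalIdeal_quotient_X_pow_add_C_eq p hm, Ideal.span_singleton_pow, pow_mul, hπ,
    Ideal.span_singleton_eq_span_singleton]
  exact (Associated.refl ((p : IwasawaAlgebra p ⧸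
    Ideal.span {(PowerSeries.X ^ m + PowerSeries.C (p : ℤ_[p]) : IwasawaAlgebra p)}))).neg_left.pow_pow

namespace EisensteinCoeff

variable {p}

/-- **`ker(S_m ↠ A_{m,k}) = 𝔪_{S_m}^{mk}`** (`= (p^k)`): the `ker_algebraMap` clause of the part-B typing for
`R_k := A_{m,k}`, `e_k := mk`. [cite: Howard2004HeegnerKolyvagin, §1.6 (arXiv p. 11, L18–20: R_k = R/𝔪^k) and proof of Thm. 2.2.10] -/
theorem ker_ofSpec {m : ℕ} (hm : 1 ≤ m) (k : ℕ) :
    RingHom.ker (ofSpec p m k) = @maximalIdeal _ _ (isLocalRing_quotient_X_pow_add_C p hm) ^ (m * k) := by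
  rw [maximalIdeal_pow_mul_eq_span_natCast_pow p hm k]
  ext s
  rw [RingHom.mem_ker, ofSpec_eq_zero_iff, Ideal.mem_span_singleton']
  constructor
  · rintro ⟨c, rfl⟩
    exact ⟨c, rfl⟩
  · rintro ⟨c, rfl⟩
    exact ⟨c, rfl⟩

/-- **`ker(A_{m,k'} ↠ A_{m,k}) = p^k A_{m,k'}`** for `k ≤ k'`: `reduce x = 0 ↔ x = c·p^k`.
[cite: Howard2004HeegnerKolyvagin, §2.2 (T_𝔮/p^{k'} ↠ T_𝔮/p^k)] -/
theorem reduce_eq_zero_iff (m : ℕ) {k k' : ℕ} (hkk' : k ≤ k') (x : EisensteinCoeff p m k') :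
    reduce p m hkk' x = 0 ↔ ∃ c : EisensteinCoeff p m k', x = c * (p : EisensteinCoeff p m k') ^ k := by
  obtain ⟨f, rfl⟩ := Ideal.Quotient.mk_surjective x
  have hpk : (p : EisensteinCoeff p m k') ^ k =
      Ideal.Quotient.mk _ (PowerSeries.C ((p : ℤ_[p]) ^ k)) := by
    simp only [map_pow, map_natCast]
  constructor
  · intro h
    rw [reduce_mk, Ideal.Quotient.eq_zero_iff_mem, Submodule.mem_sup] at h
    obtain ⟨a, ha, b, hb, hab⟩ := h
    obtain ⟨d, rfl⟩ := Ideal.mem_span_singleton'.mp hb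
    refine ⟨Ideal.Quotient.mk _ d, ?_⟩
    rw [hpk, ← map_mul, Ideal.Quotient.eq, ← hab]
    simpa using Ideal.mem_sup_left ha
  · rintro ⟨c, hc⟩
    obtain ⟨g, rfl⟩ := Ideal.Quotient.mk_surjective c
    rw [hpk, ← map_mul, Ideal.Quotient.eq, Submodule.mem_sup] at hc
    obtain ⟨a', ha', b', hb', hab'⟩ := hc
    rw [reduce_mk, Ideal.Quotient.eq_zero_iff_mem, Submodule.mem_sup]
    refine ⟨a', ha', b' + g * PowerSeries.C ((p : ℤ_[p]) ^ k),
      Ideal.add_mem _ ?_ (Ideal.mul_mem_left _ _ (Ideal.mem_span_singleton_self _)), ?_⟩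
    · obtain ⟨d, rfl⟩ := Ideal.mem_span_singleton'.mp hb'
      refine Ideal.mem_span_singleton'.mpr ⟨d * PowerSeries.C ((p : ℤ_[p]) ^ (k' - k)), ?_⟩
      rw [mul_assoc, ← map_mul, ← pow_add, Nat.sub_add_cancel hkk']
    · rw [← add_assoc, hab', sub_add_cancel]

end EisensteinCoeff

end IwasawaAlgebra

/-! ## §2 `ker(M ⊗ A_{m,k'} ↠ M' ⊗ A_{m,k}) = p^k · (M ⊗ A_{m,k'})` (right exactness of `⊗_ℤ`) -/

namespace ZpExtension

open scoped Pointwise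

universe w

variable {p : ℕ} [hp : Fact p.Prime] {M M' : Type w} [AddCommGroup M] [AddCommGroup M'] {m k k' : ℕ}

/-- **`ker(M ⊗ A_{m,k'}(ψ) ↠ M' ⊗ A_{m,k}(ψ)) = p^k · (M ⊗ A_{m,k'})`** for the reduction along `A_{m,k'} ↠ A_{m,k}`
(kernel `p^k A_{m,k'}`) and a surjection `f : M ↠ M'` with kernel `p^k M` (for `E`: `E[p^{k'}] ↠ E[p^k]`): the kernel
of `u ⊗ v` for surjective `u, v` is generated by `ker u ⊗ M + A ⊗ ker v` (Mathlib `TensorProduct.map_ker`), and both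
pieces are `p^k · (A ⊗ M)` here. [cite: BourbakiAlgebre1a3, Ch. II §3 no. 6 Prop. 6 (kernel of u ⊗ v for surjective u, v)] [cite: Howard2004HeegnerKolyvagin, §1.6 (arXiv p. 12: exact tower T/𝔪^k T) and §2.2] -/
theorem ker_eisensteinTwistReduceLinear (hkk' : k ≤ k') (f : M →ₗ[ℤ] M') (hf : Function.Surjective f)
    (hker : ∀ x : M, f x = 0 ↔ ∃ y : M, x = ((p : ℤ) ^ k) • y) :
    LinearMap.ker (eisensteinTwistReduceLinear (p := p) (m := m) hkk' f) =
      ((p : ℤ) ^ k) • (⊤ : Submodule ℤ (IwasawaAlgebra.EisensteinCoeff.Twisted p m k' M)) := by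
  -- the two exact pairs `A_{k'} --(p^k ·)--> A_{k'} --reduce--> A_k`, `M --(p^k •)--> M --f--> M'`
  have hg : Function.Surjective
      ((IwasawaAlgebra.EisensteinCoeff.reduce p m hkk').toAddMonoidHom.toIntLinearMap) :=
    IwasawaAlgebra.EisensteinCoeff.reduce_surjective m hkk'
  have hexg : Function.Exact
      (AddMonoidHom.mulLeft ((p : IwasawaAlgebra.EisensteinCoeff p m k') ^ k)).toIntLinearMap
      ((IwasawaAlgebra.EisensteinCoeff.reduce p m hkk').toAddMonoidHom.toIntLinearMap) := by
    intro x
    change IwasawaAlgebra.EisensteinCoeff.reduce p m hkk' x = 0 ↔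
      x ∈ Set.range fun y ↦ (p : IwasawaAlgebra.EisensteinCoeff p m k') ^ k * y
    rw [IwasawaAlgebra.EisensteinCoeff.reduce_eq_zero_iff]
    constructor
    · rintro ⟨c, rfl⟩
      exact ⟨c, mul_comm _ _⟩
    · rintro ⟨c, rfl⟩
      exact ⟨c, mul_comm _ _⟩
  have hexf : Function.Exact (DistribSMul.toLinearMap ℤ M ((p : ℤ) ^ k)) f := by
    intro x
    rw [hker]
    constructor
    · rintro ⟨y, rfl⟩
      exact ⟨y, rfl⟩
    · rintro ⟨y, rfl⟩
      exact ⟨y, rfl⟩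
  have hcast : ∀ a : IwasawaAlgebra.EisensteinCoeff p m k',
      (p : IwasawaAlgebra.EisensteinCoeff p m k') ^ k * a = ((p : ℤ) ^ k) • a := fun a ↦ by
    rw [zsmul_eq_mul, Int.cast_pow, Int.cast_natCast]
  show LinearMap.ker (TensorProduct.map
      (IwasawaAlgebra.EisensteinCoeff.reduce p m hkk').toAddMonoidHom.toIntLinearMap f :
        IwasawaAlgebra.EisensteinCoeff p m k' ⊗[ℤ] M →ₗ[ℤ] IwasawaAlgebra.EisensteinCoeff p m k ⊗[ℤ] M') = _
  rw [TensorProduct.map_ker hexg hg hexf hf]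
  apply le_antisymm
  · refine sup_le ?_ ?_
    · rintro _ ⟨y, rfl⟩
      induction y using TensorProduct.induction_on with
      | zero => rw [map_zero]; exact Submodule.zero_mem _
      | tmul a x =>
        rw [LinearMap.lTensor_tmul, DistribSMul.toLinearMap_apply]
        change (IwasawaAlgebra.EisensteinCoeff.Twisted.tmul a (((p : ℤ) ^ k) • x) :
            IwasawaAlgebra.EisensteinCoeff.Twisted p m k' M) ∈ _
        rw [IwasawaAlgebra.EisensteinCoeff.Twisted.tmul_zsmul]
        exact Submodule.smul_mem_pointwise_smul _ _ _ Submodule.mem_top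
      | add y z hy hz => rw [map_add]; exact Submodule.add_mem _ hy hz
    · rintro _ ⟨y, rfl⟩
      induction y using TensorProduct.induction_on with
      | zero => rw [map_zero]; exact Submodule.zero_mem _
      | tmul a x =>
        rw [LinearMap.rTensor_tmul]
        change (IwasawaAlgebra.EisensteinCoeff.Twisted.tmul ((p : IwasawaAlgebra.EisensteinCoeff p m k') ^ k * a) x :
            IwasawaAlgebra.EisensteinCoeff.Twisted p m k' M) ∈ _
        rw [hcast, IwasawaAlgebra.EisensteinCoeff.Twisted.zsmul_tmul,
          IwasawaAlgebra.EisensteinCoeff.Twisted.tmul_zsmul]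
        exact Submodule.smul_mem_pointwise_smul _ _ _ Submodule.mem_top
      | add y z hy hz => rw [map_add]; exact Submodule.add_mem _ hy hz
  · intro y hy
    obtain ⟨z, -, rfl⟩ := (Submodule.mem_smul_pointwise_iff_exists
      (M := IwasawaAlgebra.EisensteinCoeff.Twisted p m k' M) y ((p : ℤ) ^ k) ⊤).mp hy
    refine Submodule.mem_sup_left ⟨z, ?_⟩
    rw [LinearMap.lTensor_smul_action]
    rfl

/-- Membership form: `r(x) = 0 ↔ x = p^k · y`. [cite: BourbakiAlgebre1a3, Ch. II §3 no. 6 Prop. 6] [cite: Howard2004HeegnerKolyvagin, §2.2] -/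
theorem eisensteinTwistReduceLinear_eq_zero_iff (hkk' : k ≤ k') (f : M →ₗ[ℤ] M') (hf : Function.Surjective f)
    (hker : ∀ x : M, f x = 0 ↔ ∃ y : M, x = ((p : ℤ) ^ k) • y)
    (x : IwasawaAlgebra.EisensteinCoeff.Twisted p m k' M) :
    eisensteinTwistReduceLinear (p := p) (m := m) hkk' f x = 0 ↔
      ∃ y : IwasawaAlgebra.EisensteinCoeff.Twisted p m k' M, x = ((p : ℤ) ^ k) • y := by
  rw [← LinearMap.mem_ker, ker_eisensteinTwistReduceLinear hkk' f hf hker, Submodule.mem_smul_pointwise_iff_exists]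
  constructor
  · rintro ⟨y, -, rfl⟩
    exact ⟨y, rfl⟩
  · rintro ⟨y, rfl⟩
    exact ⟨y, Submodule.mem_top, rfl⟩

/-! ## §3 `ker(T_𝔮/p^{k+1} ↠ T_𝔮/p^k) = 𝔪^{mk} · (T_𝔮/p^{k+1})`: the `ker_red` clause for the Eisenstein tower -/

section Level

variable {K : Type} [Field K] (κ : ZpExtension K p)
  {N : ℕ → Type} [∀ k, AddCommGroup (N k)] [∀ k, TopologicalSpace (N k)] [∀ k, DiscreteTopology (N k)]
  (ρ : ∀ k, DiscreteGaloisModule K (N k))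
  (t : ∀ k, (ρ (k + 1)).toContRepresentation →ⁱL (ρ k).toContRepresentation)
  (hm : 1 ≤ m)

/-- **EXACTNESS of the Eisenstein tower**: for `t k : M_{k+1} ↠ M_k` surjective with kernel `p^k M_{k+1}` (for
`E`: multiplication by `p` on `E[p^{k+1}]`, kernel `E[p] = p^k E[p^{k+1}]`), the `S_m`-linear reduction
`M_{k+1} ⊗ A_{m,k+1}(ψ) ↠ M_k ⊗ A_{m,k}(ψ)` has kernel `𝔪_{S_m}^{mk} · (M_{k+1} ⊗ A_{m,k+1})` — level `k` IS
`(level k+1)/𝔪^{mk}`, the `ker_red` clause of the part-B typing `DVRSetting.SatisfiesH` for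
`eisensteinAdicTower` (for `eisensteinAdicTowerSucc` read at `k+1`). [cite: Howard2004HeegnerKolyvagin, §1.6 (arXiv p. 12, L29–55: the exact tower T/𝔪^k T) and §2.2, proof of Thm. 2.2.10 (𝔮 = T^m + p)] [cite: BourbakiAlgebre1a3, Ch. II §3 no. 6 Prop. 6] -/
theorem ker_eisensteinLevelRed (k : ℕ) (ht : Function.Surjective (t k))
    (hkt : ∀ x : N (k + 1), t k x = 0 ↔ ∃ y : N (k + 1), x = ((p : ℤ) ^ k) • y) :
    LinearMap.ker (κ.eisensteinLevelRed ρ t hm k) =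
      (@maximalIdeal _ _ (IwasawaAlgebra.isLocalRing_quotient_X_pow_add_C p hm) ^ (m * k)) •
        (⊤ : Submodule (IwasawaAlgebra p ⧸
          Ideal.span {(PowerSeries.X ^ m + PowerSeries.C (p : ℤ_[p]) : IwasawaAlgebra p)})
          (EisensteinLevel p m N (k + 1))) := by
  letI := IwasawaAlgebra.isLocalRing_quotient_X_pow_add_C p hm
  rw [IwasawaAlgebra.maximalIdeal_pow_mul_eq_span_natCast_pow p hm k, Submodule.ideal_span_singleton_smul]
  -- the scalar `(p : S_m)^k` acts on the level as the integer `p^k`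
  have hsmul : ∀ y : IwasawaAlgebra.EisensteinCoeff.Twisted p m (k + 1) (N (k + 1)),
      ((p : IwasawaAlgebra p ⧸
          Ideal.span {(PowerSeries.X ^ m + PowerSeries.C (p : ℤ_[p]) : IwasawaAlgebra p)}) ^ k) •
        (id y : EisensteinLevel p m N (k + 1)) = ((p : ℤ) ^ k) • y := fun y ↦
    (congrArg (· • (id y : EisensteinLevel p m N (k + 1)))
      (by rw [Int.cast_pow, Int.cast_natCast] :
        ((p : IwasawaAlgebra p ⧸
          Ideal.span {(PowerSeries.X ^ m + PowerSeries.C (p : ℤ_[p]) : IwasawaAlgebra p)}) ^ k) =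
          ((((p : ℤ) ^ k : ℤ)) : IwasawaAlgebra p ⧸
            Ideal.span {(PowerSeries.X ^ m + PowerSeries.C (p : ℤ_[p]) : IwasawaAlgebra p)}))).trans
      (Int.cast_smul_eq_zsmul _ ((p : ℤ) ^ k) (id y : EisensteinLevel p m N (k + 1)))
  have hf : Function.Surjective ((t k).toContinuousLinearMap.toLinearMap) := ht
  ext x
  rw [LinearMap.mem_ker, Submodule.mem_smul_pointwise_iff_exists]
  constructor
  · intro hx
    obtain ⟨y, hy⟩ := (eisensteinTwistReduceLinear_eq_zero_iff (p := p) (m := m) (Nat.le_succ k)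
      (t k).toContinuousLinearMap.toLinearMap hf hkt x).mp hx
    exact ⟨y, Submodule.mem_top, (hsmul y).trans hy.symm⟩
  · rintro ⟨y, -, rfl⟩
    exact (eisensteinTwistReduceLinear_eq_zero_iff (p := p) (m := m) (Nat.le_succ k)
      (t k).toContinuousLinearMap.toLinearMap hf hkt _).mpr ⟨y, hsmul y⟩

end Level

end ZpExtension

end Literature.NumberTheory.EllipticCurves

/-! ## §4 The `E`-instance of the hypotheses: `E[p^{k+1}] →(p·) E[p^k]` is onto with kernel `p^k E[p^{k+1}]` -/

namespace WeierstrassCurve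

open Literature.NumberTheory.EllipticCurves Literature.NumberTheory.GaloisRepresentations

universe u

variable {F : Type u} [Field F] (W : WeierstrassCurve F) [W.IsElliptic] {p : ℕ} [hp : Fact p.Prime]

/-- **Any lift `t : E[p^{k+1}] → E[p^k]` of multiplication by `p` is surjective** (`E(F̄)` is divisible:
tree `zsmul_geomPoints_surjective_holds`; a `p`-th root of a `p^k`-torsion point is `p^{k+1}`-torsion) —
the `red_surjective`/`ht` input of `ZpExtension.eisensteinAdicTower` for `M_k = E[p^k]`.
[cite: SilvermanAEC2009, §VIII.2 (0 → E[m] → E(K̄) → E(K̄) → 0)] [cite: Howard2004HeegnerKolyvagin, §2.2 (T_𝔮/p^{k+1} ↠ T_𝔮/p^k)] -/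
theorem torsionGaloisModule_lift_surjective (k : ℕ)
    (t : (W.torsionGaloisModule ((p : ℤ) ^ (k + 1))).toContRepresentation →ⁱL
      (W.torsionGaloisModule ((p : ℤ) ^ k)).toContRepresentation)
    (ht : ∀ P : geomTorsion W ((p : ℤ) ^ (k + 1)),
      ((t P : geomTorsion W ((p : ℤ) ^ k)) : geomPoints W) = (p : ℤ) • (P : geomPoints W)) :
    Function.Surjective t := by
  intro R
  obtain ⟨Q₀, hQ₀⟩ := W.zsmul_geomPoints_surjective_holds (n := (p : ℤ))
    (by exact_mod_cast hp.out.ne_zero) (R : geomPoints W)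
  change (p : ℤ) • Q₀ = (R : geomPoints W) at hQ₀
  have hQ₀mem : Q₀ ∈ geomTorsion W ((p : ℤ) ^ (k + 1)) := by
    rw [mem_geomTorsion_iff, pow_succ, ← smul_smul, hQ₀]
    exact (mem_geomTorsion_iff W _ _).mp R.2
  exact ⟨⟨Q₀, hQ₀mem⟩, Subtype.ext (by rw [ht]; exact hQ₀)⟩

/-- **The kernel of a lift `t : E[p^{k+1}] → E[p^k]` of multiplication by `p` is `p^k · E[p^{k+1}]`**
(`= E[p]`; divisibility of `E(F̄)` again) — the hypothesis `hkt` of `ZpExtension.ker_eisensteinLevelRed` /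
`ker_eisensteinTwistReduceLinear` for `M_k = E[p^k]`, i.e. the `E`-side input of the EXACTNESS of the
Eisenstein tower. [cite: SilvermanAEC2009, §VIII.2 (0 → E[m] → E(K̄) → E(K̄) → 0), Cor. III.6.4(b)] [cite: Howard2004HeegnerKolyvagin, §1.6 (arXiv p. 12: exact tower) and §2.2] -/
theorem torsionGaloisModule_lift_eq_zero_iff (k : ℕ)
    (t : (W.torsionGaloisModule ((p : ℤ) ^ (k + 1))).toContRepresentation →ⁱL
      (W.torsionGaloisModule ((p : ℤ) ^ k)).toContRepresentation)
    (ht : ∀ P : geomTorsion W ((p : ℤ) ^ (k + 1)),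
      ((t P : geomTorsion W ((p : ℤ) ^ k)) : geomPoints W) = (p : ℤ) • (P : geomPoints W))
    (P : geomTorsion W ((p : ℤ) ^ (k + 1))) :
    t P = 0 ↔ ∃ Q : geomTorsion W ((p : ℤ) ^ (k + 1)), P = ((p : ℤ) ^ k) • Q := by
  constructor
  · intro h0
    have hP : (p : ℤ) • (P : geomPoints W) = 0 := by
      rw [← ht, h0]
      rfl
    obtain ⟨Q₀, hQ₀⟩ := W.zsmul_geomPoints_surjective_holds (n := (p : ℤ) ^ k)
      (pow_ne_zero k (by exact_mod_cast hp.out.ne_zero)) (P : geomPoints W)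
    change ((p : ℤ) ^ k) • Q₀ = (P : geomPoints W) at hQ₀
    have hQ₀mem : Q₀ ∈ geomTorsion W ((p : ℤ) ^ (k + 1)) := by
      rw [mem_geomTorsion_iff, pow_succ', ← smul_smul, hQ₀, hP]
    refine ⟨⟨Q₀, hQ₀mem⟩, Subtype.ext ?_⟩
    rw [AddSubgroupClass.coe_zsmul]
    exact hQ₀.symm
  · rintro ⟨Q, rfl⟩
    apply Subtype.ext
    rw [ht, ZeroMemClass.coe_zero, AddSubgroupClass.coe_zsmul, smul_smul, ← pow_succ']
    exact (mem_geomTorsion_iff W _ _).mp Q.2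

end WeierstrassCurve

end
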